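import Literature.Computability.QuantumComplexity.OracleSimReplay
import Literature.Computability.Complexity.FoldBricks
import Literature.Computability.Complexity.TruthTableFunctions
import Literature.Computability.Complexity.TM2Iterate
import HarnessLib

/-!
# The replay of an oracle algorithm against answer slots is polynomial time

Topic `Literature/Computability/QuantumComplexity`; third file of the discharge of the named fact
`uniformOracleCoinSimulation` (`CoinFamilyKernel.lean`; Bernstein–Vazirani 1997, Thm. 8.3 with
§8.3). The garbage-free classical block of the simulating circuit computes the string function

  `replayFn M r ⟨x', ans⟩ = F₀ F₁ ⋯ F_{R-1} b`

of `OracleSimReplay.lean` (`OSim.wordσ`): `R = Q = r(|x'|)`, `F_s = padTo Q` (query of round `s` of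
the replay of the oracle algorithm `M` on `x'` against the slots `σ s ℓ = ans[s(Q+1)+ℓ]`), `b` the
first output within `R` rounds. This file writes that function in the brick algebra of
`BrickAlgebra.lean` / `FoldBricks.lean` (records, projections, counted loops `Brick.loopStep`) and
proves it polynomial time and correct:

* `OSim.stepCodeL_comp_mem_FP` — the step function of a polynomial-time oracle algorithm with
  string outputs (its `sumBool` code `Complexity.stepCodeL` of `TruthTableFunctions.lean`),
  precomposed with `FP` maps producing its input and its one-bit transcript, is an `FP` string map
  (twin of `PRelSigma.stepCode_comp_mem_FP` for `OracleAlg (List Bool)`);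
* the round bodies `OSim.bodyF` (fields loop: transcript, fields, remaining slots) and `OSim.bodyO`
  (output loop: transcript, found-flag, remaining slots), their growth bounds on *every* record
  (`length_bodyF_le`, `length_bodyO_le`, what `Brick.loopFn_mem_FP` asks), and
  **`OSim.replayFn_mem_FP`**;
* the semantics on well-formed inputs: `bodyF_rec` / `bodyO_*` (one round is one round of
  `OSim.asσ`/`OSim.fieldsσ`, resp. one step of the scan `OSim.firstOut`), and
  **`OSim.replayFn_apply`**: `replayFn M r (boolPair x' ans) = wordσ M x' σ R Q`.

## References

* E. Bernstein, U. Vazirani, *Quantum complexity theory*, SIAM J. Comput. 26 (1997), Thm. 8.3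
  (proof: "a polynomial time deterministic TM" run inside the quantum machine) and §8.3
  [BernsteinVazirani1997SICOMP].
* S. Arora, B. Barak, *Computational Complexity: A Modern Approach*, CUP 2009, §1.3 (polynomial
  time is closed under composition and bounded loops), §3.4 (oracle machines: replay from the input
  and the answers) [AroraBarak2009].
-/

noncomputable section

namespace Literature.Computability.QuantumComplexity

namespace OSim

open _root_.Computability Polynomial Complexity Complexity.Brick Complexity.Plumb Complexity.PRelSigma
  Complexity.HashBricks

/-! ### The step function as a string map -/

variable (M : OracleAlg (List Bool)) (r : Polynomial ℕ)

/-- **A polynomial-time step function, precomposed with `FP` maps producing its input and its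
one-bit transcript, is an `FP` string map.** [cite: AroraBarak2009, §1.3 (composition)] -/
theorem stepCodeL_comp_mem_FP (hM : M.IsPolyTime (encodingList Bool)) {f g : List Bool → List Bool}
    (hf : f ∈ FP) (hg : g ∈ FP) : (fun v => stepCodeL (M.step (f v) (bitsTrans (g v)))) ∈ FP := by
  have hin : pairFn f (codeOf ∘ g) ∈ FP := pairFn_mem_FP hf (comp_mem_FP codeOf_mem_FP hg)
  have hG : PolyTimeComputable (id : List Bool → List Bool)
      (fun p : List Bool × List (List Bool) => boolPair p.1 ((encodingList Bool).listBool.encode p.2))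
      (fun v => (f v, bitsTrans (g v))) := by
    obtain ⟨p, Mx, h⟩ := hin
    refine ⟨p, Mx, fun v => ?_⟩
    have hv := h v
    simp only [id, pairFn_apply, Function.comp_apply, codeOf] at hv ⊢
    exact hv
  obtain ⟨p, Mx, h⟩ := PolyTimeComputable.comp_holds hM hG
  exact ⟨p, Mx, fun v => h v⟩

/-! ### The bricks of one round -/

/-- The input `x'` of the oracle algorithm, read off the loop record `⟨⟨x', ans⟩, ⟨cnt, state⟩⟩`.
[folklore] -/
def xF : List Bool → List Bool := fstF ∘ nthF 0

/-- `1^{min(Q, |X|)}` with `Q = r(|x'|)`, `X = ⟨x', ans⟩` (the clip by `|X|` is what bounds the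
growth of a round on malformed records; it is inactive on the records of the simulation).
[folklore] -/
def qwF : List Bool → List Bool := takeFn ∘ fanoutFn (nthF 0) (polyFn r ∘ xF)

/-- The step code of the current round: the transcript is field `2` of the record. [folklore] -/
def codeF : List Bool → List Bool := fun v => stepCodeL (M.step (xF v) (bitsTrans (nthF 2 v)))

/-- The query of the current round (`[]` if the step is an output). [folklore] -/
def qryF : List Bool → List Bool := iteFn (headBitFn ∘ codeF M) (fun _ => []) (List.tail ∘ codeF M)

/-- The query padded with zeros and clipped to the length of `qwF`. [folklore] -/
def padF : List Bool → List Bool := takeFn ∘ fanoutFn (qwF r) (fun v => qryF M v ++ Kannan.zerosFn (qwF r v))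

/-- The answer bit, read in the remaining slots (last field) at the position of the query's length,
as a one-bit string. [folklore] -/
def bitF : List Bool → List Bool := headBitFn ∘ dropFn ∘ fanoutFn (qryF M) (sndPow 3)

/-- The remaining slots after the round: drop the `|qwF| + 1` slots of this round. [folklore] -/
def restF : List Bool → List Bool := dropFn ∘ fanoutFn (List.cons true ∘ qwF r) (sndPow 3)

/-- **The body of the fields loop** on states `⟨as, ⟨acc, rest⟩⟩`: append the answer bit to the
transcript, the padded query to the fields, and advance the slots. [cite: AroraBarak2009, §3.4] -/
def bodyF : List Bool → List Bool :=
  fanoutFn (fun v => nthF 2 v ++ bitF M v) (fanoutFn (fun v => nthF 3 v ++ padF M r v) (restF r))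

/-- **The body of the output loop** on states `⟨as, ⟨flag, rest⟩⟩`: once the flag is raised, idle;
if the step is an output, raise the flag; otherwise extend the transcript and advance the slots.
[cite: AroraBarak2009, §3.4] -/
def bodyO : List Bool → List Bool :=
  iteFn (headBitFn ∘ nthF 3) (sndPow 1)
    (iteFn (headBitFn ∘ codeF M)
      (fanoutFn (nthF 2) (fanoutFn (fun _ => [true]) (sndPow 3)))
      (fanoutFn (fun v => nthF 2 v ++ bitF M v) (fanoutFn (fun _ => []) (restF r))))

/-- The initial record `⟨z, ⟨bin R, ⟨[], ⟨[], ans⟩⟩⟩⟩` of both loops on the input `z = ⟨x', ans⟩`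
(`R = r(|x'|)`). [folklore] -/
def initR : List Bool → List Bool :=
  fanoutFn (fun z => z) (fanoutFn (lenBinF ∘ polyFn r ∘ fstF) (fanoutFn (fun _ => []) (fanoutFn (fun _ => []) sndF)))

/-- The fields loop: `r(|z|) ≥ R` rounds. [folklore] -/
def loopF : List Bool → List Bool := fun z => (loopStep (bodyF M r))^[r.eval (fstF z).length] z

/-- The output loop: `r(|z|) ≥ R` rounds. [folklore] -/
def loopO : List Bool → List Bool := fun z => (loopStep (bodyO M r))^[r.eval (fstF z).length] z

/-- The fields `F₀ ⋯ F_{R-1}`. [folklore] -/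
def fieldsFn : List Bool → List Bool := nthF 3 ∘ loopF M r ∘ initR r

/-- The output part: the output found by the scan, or nothing. [folklore] -/
def outFn : List Bool → List Bool :=
  iteFn (headBitFn ∘ nthF 3 ∘ loopO M r ∘ initR r) (List.tail ∘ codeF M ∘ loopO M r ∘ initR r) (fun _ => [])

/-- **The replay function** computed by the block of the simulating circuit.
[cite: BernsteinVazirani1997SICOMP, Thm. 8.3 (proof)] -/
def replayFn : List Bool → List Bool := fun z => fieldsFn M r z ++ outFn M r z

/-! ### Polynomial time -/

section FP

variable {M}

/-- `xF ∈ FP`. [folklore] -/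
theorem xF_mem_FP : xF ∈ FP := comp_mem_FP fstF_mem_FP (nthF_mem_FP 0)

/-- `qwF ∈ FP`. [folklore] -/
theorem qwF_mem_FP : qwF r ∈ FP :=
  comp_mem_FP takeFn_mem_FP (fanoutFn_mem_FP (nthF_mem_FP 0) (comp_mem_FP (polyFn_mem_FP r) xF_mem_FP))

/-- `codeF ∈ FP`. [folklore] -/
theorem codeF_mem_FP (hM : M.IsPolyTime (encodingList Bool)) : codeF M ∈ FP :=
  stepCodeL_comp_mem_FP M hM xF_mem_FP (nthF_mem_FP 2)

/-- `qryF ∈ FP`. [folklore] -/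
theorem qryF_mem_FP (hM : M.IsPolyTime (encodingList Bool)) : qryF M ∈ FP :=
  iteFn_mem_FP (comp_mem_FP headBitFn_mem_FP (codeF_mem_FP hM)) (const_mem_FP _)
    (comp_mem_FP tail_mem_FP (codeF_mem_FP hM))

/-- `padF ∈ FP`. [folklore] -/
theorem padF_mem_FP (hM : M.IsPolyTime (encodingList Bool)) : padF M r ∈ FP :=
  comp_mem_FP takeFn_mem_FP (fanoutFn_mem_FP (qwF_mem_FP r)
    (append_mem_FP (qryF_mem_FP hM) (comp_mem_FP Kannan.zerosFn_mem_FP (qwF_mem_FP r))))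

/-- `bitF ∈ FP`. [folklore] -/
theorem bitF_mem_FP (hM : M.IsPolyTime (encodingList Bool)) : bitF M ∈ FP :=
  comp_mem_FP headBitFn_mem_FP (comp_mem_FP dropFn_mem_FP (fanoutFn_mem_FP (qryF_mem_FP hM) (sndPow_mem_FP 3)))

/-- `restF ∈ FP`. [folklore] -/
theorem restF_mem_FP : restF r ∈ FP :=
  comp_mem_FP dropFn_mem_FP (fanoutFn_mem_FP (comp_mem_FP (cons_mem_FP true) (qwF_mem_FP r)) (sndPow_mem_FP 3))

/-- `bodyF ∈ FP`. [folklore] -/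
theorem bodyF_mem_FP (hM : M.IsPolyTime (encodingList Bool)) : bodyF M r ∈ FP :=
  fanoutFn_mem_FP (append_mem_FP (nthF_mem_FP 2) (bitF_mem_FP hM))
    (fanoutFn_mem_FP (append_mem_FP (nthF_mem_FP 3) (padF_mem_FP r hM)) (restF_mem_FP r))

/-- `bodyO ∈ FP`. [folklore] -/
theorem bodyO_mem_FP (hM : M.IsPolyTime (encodingList Bool)) : bodyO M r ∈ FP :=
  iteFn_mem_FP (comp_mem_FP headBitFn_mem_FP (nthF_mem_FP 3)) (sndPow_mem_FP 1)
    (iteFn_mem_FP (comp_mem_FP headBitFn_mem_FP (codeF_mem_FP hM))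
      (fanoutFn_mem_FP (nthF_mem_FP 2) (fanoutFn_mem_FP (const_mem_FP _) (sndPow_mem_FP 3)))
      (fanoutFn_mem_FP (append_mem_FP (nthF_mem_FP 2) (bitF_mem_FP hM)) (fanoutFn_mem_FP (const_mem_FP _) (restF_mem_FP r))))

/-- `initR ∈ FP`. [folklore] -/
theorem initR_mem_FP : initR r ∈ FP :=
  fanoutFn_mem_FP (PolyTimeComputable.id _) (fanoutFn_mem_FP (comp_mem_FP lenBinF_mem_FP (comp_mem_FP (polyFn_mem_FP r) fstF_mem_FP))
    (fanoutFn_mem_FP (const_mem_FP _) (fanoutFn_mem_FP (const_mem_FP _) sndF_mem_FP)))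

end FP

/-! ### Growth of one round (on every record) -/

/-- The clipped unary count is at most as long as the context. [folklore] -/
theorem length_qwF_le (v : List Bool) : (qwF r v).length ≤ (fstF v).length := by
  simp only [qwF, Function.comp_apply, fanoutFn_apply, takeFn_boolPair, nthF_zero]
  exact List.length_take_le _ _

/-- The padded query is at most as long as the context. [folklore] -/
theorem length_padF_le (v : List Bool) : (padF M r v).length ≤ (fstF v).length := by
  simp only [padF, Function.comp_apply, fanoutFn_apply, takeFn_boolPair]
  exact (List.length_take_le _ _).trans (length_qwF_le r v)

/-- The answer bit is one bit. [folklore] -/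
@[simp] theorem length_bitF (v : List Bool) : (bitF M v).length = 1 := by
  simp [bitF]

/-- The remaining slots do not grow. [folklore] -/
theorem length_restF_le (v : List Bool) : (restF r v).length ≤ (sndPow 3 v).length := by
  simp only [restF, Function.comp_apply, fanoutFn_apply, dropFn_boolPair, List.length_drop]
  exact Nat.sub_le _ _

/-- The three fields of a state, measured on every string. [folklore] -/
theorem length_fields_le (v : List Bool) :
    2 * (nthF 2 v).length + 2 * (nthF 3 v).length + (sndPow 3 v).length ≤ (sndPow 1 v).length := by
  have h1 := length_fstF_sndF_le (sndPow 1 v)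
  have h2 := length_fstF_sndF_le (sndF (sndPow 1 v))
  have e2 : nthF 2 v = fstF (sndPow 1 v) := by simp [nthF, sndPow]
  have e3 : nthF 3 v = fstF (sndF (sndPow 1 v)) := by simp [nthF, sndPow]
  have e4 : sndPow 3 v = sndF (sndF (sndPow 1 v)) := by simp [sndPow]
  rw [e2, e3, e4]
  omega

/-- **Growth of the fields body**: `|bodyF v| ≤ |state| + 6 (|context| + 1)`. [folklore] -/
theorem length_bodyF_le (v : List Bool) :
    (bodyF M r v).length ≤ (sndPow 1 v).length + 6 * ((fstF v).length + 1) := by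
  have h := length_fields_le v
  have hp := length_padF_le M r v
  have hr := length_restF_le r v
  simp only [bodyF, fanoutFn_apply, length_boolPair, List.length_append, length_bitF]
  omega

/-- **Growth of the output body**: `|bodyO v| ≤ |state| + 6 (|context| + 1)`. [folklore] -/
theorem length_bodyO_le (v : List Bool) :
    (bodyO M r v).length ≤ (sndPow 1 v).length + 6 * ((fstF v).length + 1) := by
  have h := length_fields_le v
  have hr := length_restF_le r v
  rw [bodyO, iteFn_of_oneBit (oneBit_headBitFn.comp _)]
  split_ifs
  · omega
  · rw [iteFn_of_oneBit (oneBit_headBitFn.comp _)]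
    split_ifs
    · simp only [fanoutFn_apply, length_boolPair, List.length_cons, List.length_nil]
      omega
    · simp only [fanoutFn_apply, length_boolPair, List.length_append, length_bitF, List.length_nil]
      omega

section FP2

variable {M} (hM : M.IsPolyTime (encodingList Bool))
include hM

/-- `loopF ∈ FP`. [cite: AroraBarak2009, §1.3 (bounded loops)] -/
theorem loopF_mem_FP : loopF M r ∈ FP :=
  loopFn_mem_FP (bodyF_mem_FP r hM) (fun v => length_bodyF_le M r v) r

/-- `loopO ∈ FP`. [cite: AroraBarak2009, §1.3 (bounded loops)] -/
theorem loopO_mem_FP : loopO M r ∈ FP :=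
  loopFn_mem_FP (bodyO_mem_FP r hM) (fun v => length_bodyO_le M r v) r

/-- `fieldsFn ∈ FP`. [folklore] -/
theorem fieldsFn_mem_FP : fieldsFn M r ∈ FP :=
  comp_mem_FP (nthF_mem_FP 3) (comp_mem_FP (loopF_mem_FP r hM) (initR_mem_FP r))

/-- `outFn ∈ FP`. [folklore] -/
theorem outFn_mem_FP : outFn M r ∈ FP :=
  iteFn_mem_FP (comp_mem_FP headBitFn_mem_FP (comp_mem_FP (nthF_mem_FP 3) (comp_mem_FP (loopO_mem_FP r hM) (initR_mem_FP r))))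
    (comp_mem_FP tail_mem_FP (comp_mem_FP (codeF_mem_FP hM) (comp_mem_FP (loopO_mem_FP r hM) (initR_mem_FP r))))
    (const_mem_FP _)

/-- **The replay function is polynomial time.** [cite: BernsteinVazirani1997SICOMP, Thm. 8.3 (proof)] -/
theorem replayFn_mem_FP : replayFn M r ∈ FP :=
  append_mem_FP (fieldsFn_mem_FP r hM) (outFn_mem_FP r hM)

end FP2

/-! ### Semantics of one round on well-formed records -/

section Semantics

variable {M r}

/-- The slot function read off the slot string: slot `(s, ℓ)` is bit `s (Q+1) + ℓ`. [folklore] -/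
def slotσ (ans : List Bool) (Q : ℕ) : ℕ → ℕ → Bool := fun s ℓ => ans.getD (s * (Q + 1) + ℓ) false

/-- A record of the loops: context `⟨x', ans⟩`, a counter, and a state with three fields. [folklore] -/
def rec (x' ans cnt a f3 rest : List Bool) : List Bool :=
  boolPair (boolPair x' ans) (boolPair cnt (boolPair a (boolPair f3 rest)))

variable (x' ans cnt a f3 rest : List Bool)

/-- Projection: the input. [folklore] -/
@[simp] theorem xF_rec : xF (rec x' ans cnt a f3 rest) = x' := by simp [xF, rec]
/-- Projection: the context. [folklore] -/
@[simp] theorem nthF_zero_rec : nthF 0 (rec x' ans cnt a f3 rest) = boolPair x' ans := by simp [rec]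
/-- Projection: field `2`. [folklore] -/
@[simp] theorem nthF_two_rec : nthF 2 (rec x' ans cnt a f3 rest) = a := by simp [rec, nthF]
/-- Projection: field `3`. [folklore] -/
@[simp] theorem nthF_three_rec : nthF 3 (rec x' ans cnt a f3 rest) = f3 := by simp [rec, nthF]
/-- Projection: the last field. [folklore] -/
@[simp] theorem sndPow_three_rec : sndPow 3 (rec x' ans cnt a f3 rest) = rest := by simp [rec, sndPow]
/-- Projection: the state. [folklore] -/
@[simp] theorem sndPow_one_rec : sndPow 1 (rec x' ans cnt a f3 rest) = boolPair a (boolPair f3 rest) := by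
  simp [rec, sndPow]

/-- The unary count is `1^Q`, `Q = r(|x'|)`, as soon as `Q ≤ |⟨x', ans⟩|`. [folklore] -/
theorem qwF_rec (hQ : r.eval x'.length ≤ (boolPair x' ans).length) :
    qwF r (rec x' ans cnt a f3 rest) = ones (r.eval x'.length) := by
  simp only [qwF, Function.comp_apply, fanoutFn_apply, nthF_zero_rec, xF_rec, polyFn_apply, takeFn_boolPair]
  exact List.take_of_length_le (by simpa using hQ)

/-- The step code of the round. [folklore] -/
theorem codeF_rec : codeF M (rec x' ans cnt a f3 rest) = stepCodeL (M.step x' (bitsTrans a)) := by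
  simp [codeF]

/-- **The query brick computes `qryOf`.** [folklore] -/
theorem qryF_rec : qryF M (rec x' ans cnt a f3 rest) = qryOf M x' (bitsTrans a) := by
  unfold qryF qryOf
  cases hs : M.step x' (bitsTrans a) with
  | inl y =>
    rw [iteFn_apply_false (by simp [codeF_rec, hs])]
    simp [codeF_rec, hs]
  | inr b =>
    rw [iteFn_apply_true (by simp [codeF_rec, hs])]

/-- **The padding brick computes `padTo Q`.** [folklore] -/
theorem padF_rec (hQ : r.eval x'.length ≤ (boolPair x' ans).length) :
    padF M r (rec x' ans cnt a f3 rest) = padTo (r.eval x'.length) (qryOf M x' (bitsTrans a)) := by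
  simp only [padF, Function.comp_apply, fanoutFn_apply, qwF_rec x' ans cnt a f3 rest hQ, qryF_rec, takeFn_boolPair,
    Kannan.zerosFn_apply, List.length_replicate, padTo]

/-- The bit at position `k` of a string, through `drop` and `headD`. [folklore] -/
theorem headD_drop (l : List Bool) (k : ℕ) : (l.drop k).headD false = l.getD k false := by
  rw [List.headD_eq_head?_getD, List.head?_drop, List.getD_eq_getElem?_getD]

/-- **The answer-bit brick reads the slot at the query's length.** [folklore] -/
theorem bitF_rec : bitF M (rec x' ans cnt a f3 rest) = [rest.getD (qryOf M x' (bitsTrans a)).length false] := by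
  simp only [bitF, Function.comp_apply, fanoutFn_apply, qryF_rec, sndPow_three_rec, dropFn_boolPair, headBitFn_apply,
    headD_drop]

/-- **The slot-advance brick drops `Q + 1` slots.** [folklore] -/
theorem restF_rec (hQ : r.eval x'.length ≤ (boolPair x' ans).length) :
    restF r (rec x' ans cnt a f3 rest) = rest.drop (r.eval x'.length + 1) := by
  simp only [restF, Function.comp_apply, fanoutFn_apply, qwF_rec x' ans cnt a f3 rest hQ, sndPow_three_rec,
    dropFn_boolPair, List.length_cons, List.length_replicate]

variable {x' ans}

/-! ### The fields loop computes `fieldsσ` -/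

/-- The state of the fields loop after `s` rounds: transcript, fields, remaining slots. [folklore] -/
def stF (M : OracleAlg (List Bool)) (x' ans : List Bool) (Q s : ℕ) : List Bool :=
  boolPair (asσ M x' (slotσ ans Q) s) (boolPair (fieldsσ M x' (slotσ ans Q) s Q) (ans.drop (s * (Q + 1))))

/-- Dropping to the slots of round `s` and reading position `ℓ` reads slot `(s, ℓ)`. [folklore] -/
theorem getD_drop_slot (ans : List Bool) (Q s ℓ : ℕ) : (ans.drop (s * (Q + 1))).getD ℓ false = slotσ ans Q s ℓ := by
  rw [slotσ, List.getD_eq_getElem?_getD, List.getElem?_drop, ← List.getD_eq_getElem?_getD]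

/-- One more field. [folklore] -/
theorem fieldsσ_succ (σ : ℕ → ℕ → Bool) (s Q : ℕ) :
    fieldsσ M x' σ (s + 1) Q = fieldsσ M x' σ s Q ++ padTo Q (qryσ M x' σ s) := by
  simp [fieldsσ, List.range_succ]

/-- **One round of the fields loop is one round of the replay.** [cite: AroraBarak2009, §3.4] -/
theorem bodyF_stF (hQ : r.eval x'.length ≤ (boolPair x' ans).length) (cnt : List Bool) (s : ℕ) :
    bodyF M r (boolPair (boolPair x' ans) (boolPair cnt (stF M x' ans (r.eval x'.length) s))) =
      stF M x' ans (r.eval x'.length) (s + 1) := by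
  set Q := r.eval x'.length
  have e : boolPair (boolPair x' ans) (boolPair cnt (stF M x' ans Q s)) =
      rec x' ans cnt (asσ M x' (slotσ ans Q) s) (fieldsσ M x' (slotσ ans Q) s Q) (ans.drop (s * (Q + 1))) := rfl
  rw [e, bodyF, fanoutFn_apply, fanoutFn_apply, nthF_two_rec, nthF_three_rec, bitF_rec, padF_rec _ _ _ _ _ _ hQ,
    restF_rec _ _ _ _ _ _ hQ, stF, asσ_succ, fieldsσ_succ, qryσ, getD_drop_slot, List.drop_drop]
  congr 3
  ring

/-- The body ignores the counter, so the loop model runs the rounds. [folklore] -/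
theorem loopModel_bodyF (hQ : r.eval x'.length ≤ (boolPair x' ans).length) :
    ∀ (k s : ℕ), loopModel (bodyF M r) (boolPair x' ans) k (stF M x' ans (r.eval x'.length) s) =
      stF M x' ans (r.eval x'.length) (s + k)
  | 0, s => rfl
  | k + 1, s => by
    rw [loopModel, bodyF_stF hQ, loopModel_bodyF hQ k (s + 1), Nat.add_right_comm, Nat.add_assoc]

/-- The initial record, on a pair. [folklore] -/
theorem initR_boolPair (x' ans : List Bool) :
    initR r (boolPair x' ans) =
      boolPair (boolPair x' ans) (boolPair (encodeNat (r.eval x'.length)) (boolPair [] (boolPair [] ans))) := by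
  simp [initR, polyFn_apply]

/-- The initial state is the state of round `0` of both loops. [folklore] -/
theorem stF_zero (Q : ℕ) : stF M x' ans Q 0 = boolPair [] (boolPair [] ans) := by
  simp [stF, fieldsσ]

/-- Enough rounds are available: `R = r(|x'|) ≤ r(|⟨x', ans⟩|)`. [folklore] -/
theorem R_le_rounds (x' ans : List Bool) : r.eval x'.length ≤ r.eval (boolPair x' ans).length :=
  TM2Iter.eval_mono r (by rw [length_boolPair]; omega)

/-- **The fields loop ends with the fields of `R` rounds.** [cite: AroraBarak2009, §3.4] -/
theorem loopF_initR (hQ : r.eval x'.length ≤ (boolPair x' ans).length) :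
    loopF M r (initR r (boolPair x' ans)) =
      boolPair (boolPair x' ans) (boolPair [] (stF M x' ans (r.eval x'.length) (r.eval x'.length))) := by
  rw [loopF, initR_boolPair, fstF_boolPair, ← stF_zero (M := M) (x' := x') (r.eval x'.length),
    iterate_loopStep _ _ _ _ _ (R_le_rounds (r := r) x' ans), loopModel_bodyF hQ, Nat.zero_add]

/-- **The fields brick computes `fieldsσ`.** [cite: BernsteinVazirani1997SICOMP, Thm. 8.3 (proof)] -/
theorem fieldsFn_apply (hQ : r.eval x'.length ≤ (boolPair x' ans).length) :
    fieldsFn M r (boolPair x' ans) = fieldsσ M x' (slotσ ans (r.eval x'.length)) (r.eval x'.length) (r.eval x'.length) := by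
  rw [fieldsFn, Function.comp_apply, Function.comp_apply, loopF_initR hQ]
  simp [stF, nthF]

/-! ### The output loop computes `outσ` -/

/-- The unflagged state of the output loop at round `s`. [folklore] -/
def stO (M : OracleAlg (List Bool)) (x' ans : List Bool) (Q s : ℕ) : List Bool :=
  boolPair (asσ M x' (slotσ ans Q) s) (boolPair [] (ans.drop (s * (Q + 1))))

/-- The flagged (final) state reached at round `s`. [folklore] -/
def stD (M : OracleAlg (List Bool)) (x' ans : List Bool) (Q s : ℕ) : List Bool :=
  boolPair (asσ M x' (slotσ ans Q) s) (boolPair [true] (ans.drop (s * (Q + 1))))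

/-- **The scan**: the state of the output loop after `k` rounds started unflagged at round `s`.
[folklore] -/
def scanSt (M : OracleAlg (List Bool)) (x' ans : List Bool) (Q : ℕ) : ℕ → ℕ → List Bool
  | s, 0 => stO M x' ans Q s
  | s, k + 1 =>
    match M.step x' (bitsTrans (asσ M x' (slotσ ans Q) s)) with
    | Sum.inr _ => stD M x' ans Q s
    | Sum.inl _ => scanSt M x' ans Q (s + 1) k

/-- A flagged state is a fixed point of the body. [folklore] -/
theorem bodyO_stD (cnt : List Bool) (Q s : ℕ) :
    bodyO M r (boolPair (boolPair x' ans) (boolPair cnt (stD M x' ans Q s))) = stD M x' ans Q s := by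
  have e : boolPair (boolPair x' ans) (boolPair cnt (stD M x' ans Q s)) =
      rec x' ans cnt (asσ M x' (slotσ ans Q) s) [true] (ans.drop (s * (Q + 1))) := rfl
  rw [e, bodyO, iteFn_apply_true (by simp), sndPow_one_rec]
  rfl

/-- On an unflagged state at an output round the body raises the flag. [folklore] -/
theorem bodyO_stO_inr (cnt : List Bool) {s : ℕ} {b : List Bool}
    (hs : M.step x' (bitsTrans (asσ M x' (slotσ ans (r.eval x'.length)) s)) = Sum.inr b) :
    bodyO M r (boolPair (boolPair x' ans) (boolPair cnt (stO M x' ans (r.eval x'.length) s))) =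
      stD M x' ans (r.eval x'.length) s := by
  set Q := r.eval x'.length
  have e : boolPair (boolPair x' ans) (boolPair cnt (stO M x' ans Q s)) =
      rec x' ans cnt (asσ M x' (slotσ ans Q) s) [] (ans.drop (s * (Q + 1))) := rfl
  rw [e, bodyO, iteFn_apply_false (by simp), iteFn_apply_true (by simp [codeF_rec, hs])]
  simp [stD]

/-- On an unflagged state at a query round the body plays the round. [folklore] -/
theorem bodyO_stO_inl (hQ : r.eval x'.length ≤ (boolPair x' ans).length) (cnt : List Bool) {s : ℕ} {y : List Bool}
    (hs : M.step x' (bitsTrans (asσ M x' (slotσ ans (r.eval x'.length)) s)) = Sum.inl y) :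
    bodyO M r (boolPair (boolPair x' ans) (boolPair cnt (stO M x' ans (r.eval x'.length) s))) =
      stO M x' ans (r.eval x'.length) (s + 1) := by
  set Q := r.eval x'.length
  have e : boolPair (boolPair x' ans) (boolPair cnt (stO M x' ans Q s)) =
      rec x' ans cnt (asσ M x' (slotσ ans Q) s) [] (ans.drop (s * (Q + 1))) := rfl
  rw [e, bodyO, iteFn_apply_false (by simp), iteFn_apply_false (by simp [codeF_rec, hs]), fanoutFn_apply, fanoutFn_apply,
    nthF_two_rec, bitF_rec, restF_rec _ _ _ _ _ _ hQ, stO, asσ_succ, qryσ, getD_drop_slot, List.drop_drop]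
  congr 3
  ring

/-- A fixed point of the body stays through the loop model. [folklore] -/
theorem loopModel_fixed {body : List Bool → List Bool} {X st : List Bool}
    (h : ∀ cnt, body (boolPair X (boolPair cnt st)) = st) : ∀ k, loopModel body X k st = st
  | 0 => rfl
  | k + 1 => by rw [loopModel, h, loopModel_fixed h k]

/-- **The loop model of the output loop is the scan.** [cite: AroraBarak2009, §3.4] -/
theorem loopModel_bodyO (hQ : r.eval x'.length ≤ (boolPair x' ans).length) :
    ∀ (k s : ℕ), loopModel (bodyO M r) (boolPair x' ans) k (stO M x' ans (r.eval x'.length) s) =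
      scanSt M x' ans (r.eval x'.length) s k
  | 0, s => rfl
  | k + 1, s => by
    rw [loopModel, scanSt]
    cases hs : M.step x' (bitsTrans (asσ M x' (slotσ ans (r.eval x'.length)) s)) with
    | inr b =>
      simp only
      rw [bodyO_stO_inr (encodeNat (k + 1)) hs, loopModel_fixed (fun cnt => bodyO_stD cnt _ s) k]
    | inl y =>
      simp only
      rw [bodyO_stO_inl hQ (encodeNat (k + 1)) hs, loopModel_bodyO hQ k (s + 1)]

/-- The output read off a state of the output loop: if flagged, the tail of the step code at the
recorded transcript, else nothing. [folklore] -/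
def outOfSt (M : OracleAlg (List Bool)) (x' st : List Bool) : List Bool :=
  if headBitFn (nthF 1 st) = [true] then (stepCodeL (M.step x' (bitsTrans (fstF st)))).tail else []

/-- **The scan finds the first output.** [cite: AroraBarak2009, §3.4] -/
theorem outOfSt_scanSt (Q : ℕ) : ∀ (k s : ℕ),
    outOfSt M x' (scanSt M x' ans Q s k) = (firstOut M x' (slotσ ans Q) s k).getD []
  | 0, s => by simp [outOfSt, scanSt, stO, firstOut]
  | k + 1, s => by
    rw [scanSt, firstOut]
    cases hs : M.step x' (bitsTrans (asσ M x' (slotσ ans Q) s)) with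
    | inr b => simp [outOfSt, stD, hs]
    | inl y => exact outOfSt_scanSt Q k (s + 1)

/-- The unflagged state of round `0`. [folklore] -/
theorem stO_zero (Q : ℕ) : stO M x' ans Q 0 = boolPair [] (boolPair [] ans) := by
  simp [stO]

/-- **The output loop ends with the scan of `R` rounds.** [cite: AroraBarak2009, §3.4] -/
theorem loopO_initR (hQ : r.eval x'.length ≤ (boolPair x' ans).length) :
    loopO M r (initR r (boolPair x' ans)) =
      boolPair (boolPair x' ans) (boolPair [] (scanSt M x' ans (r.eval x'.length) 0 (r.eval x'.length))) := by
  rw [loopO, initR_boolPair, fstF_boolPair, ← stO_zero (M := M) (x' := x') (r.eval x'.length),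
    iterate_loopStep _ _ _ _ _ (R_le_rounds (r := r) x' ans), loopModel_bodyO hQ]

/-- **The output brick computes `outσ`.** [cite: BernsteinVazirani1997SICOMP, Thm. 8.3 (proof)] -/
theorem outFn_apply (hQ : r.eval x'.length ≤ (boolPair x' ans).length) :
    outFn M r (boolPair x' ans) = (outσ M x' (slotσ ans (r.eval x'.length)) (r.eval x'.length)).getD [] := by
  rw [outσ, ← outOfSt_scanSt (M := M) (x' := x') (ans := ans) (r.eval x'.length) (r.eval x'.length) 0, outFn,
    iteFn_of_oneBit (oneBit_headBitFn.comp _), outOfSt]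
  simp only [Function.comp_apply, loopO_initR hQ, codeF, xF, nthF, fstF_boolPair, sndF_boolPair]
  rfl

/-- **The replay function computes the block's word**: on `⟨x', ans⟩` with `r(|x'|) ≤ |⟨x', ans⟩|`
(true whenever `ans` has its `R (Q+1)` slots, `R = Q = r(|x'|)`), `replayFn M r ⟨x', ans⟩ = wordσ M x' σ R Q`
for the slot function `σ = slotσ ans Q`. [cite: BernsteinVazirani1997SICOMP, Thm. 8.3 (proof) with §8.3] -/
theorem replayFn_apply (hQ : r.eval x'.length ≤ (boolPair x' ans).length) :
    replayFn M r (boolPair x' ans) =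
      wordσ M x' (slotσ ans (r.eval x'.length)) (r.eval x'.length) (r.eval x'.length) := by
  rw [replayFn, fieldsFn_apply hQ, outFn_apply hQ, wordσ]

/-- The hypothesis of `replayFn_apply` for a full slot string. [folklore] -/
theorem le_length_boolPair_of_slots (x' ans : List Bool) (h : r.eval x'.length * (r.eval x'.length + 1) ≤ ans.length) :
    r.eval x'.length ≤ (boolPair x' ans).length := by
  rw [length_boolPair]; nlinarith

end Semantics

end OSim

end Literature.Computability.QuantumComplexity

end
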